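import Summits.BirchSwinnertonDyer.BirchSwinnertonDyer.Theorems.QuadraticBranchSignedControlPlusEtaNonsurjPlusCoeffCongruenceMuCertificate
import Summits.BirchSwinnertonDyer.BirchSwinnertonDyer.Theorems.QuadraticBranchSignedControlPlusEtaNonsurjFineRoadCM
import Summits.BirchSwinnertonDyer.BirchSwinnertonDyer.Theorems.QuadraticBranchSignedControlPlusEtaNonsurjConjADoor
import Literature.NumberTheory.EllipticCurves.ZywinaCMImageProofs
import Summits.BirchSwinnertonDyer.BirchSwinnertonDyer.Theorems.QuadraticBranchSignedControlPlusEtaNonsurjCMUnitRecordShape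
import Summits.BirchSwinnertonDyer.Rank1Residual.X12.InertCoreUpperHalf
import Summits.BirchSwinnertonDyer.Rank1Residual.X11b.KrausMinimalityGeneralTwo
import HarnessLib

/-!
# Route `QuadraticBranchSignedControl` (rung K8, cell `bsd-potss`), residual crux `PlusEtaMainConjectureNonsurj`
# (stmt-BirchSwinnertonDyer-19606): RECORDS A — THE CRUX'S CONCLUSION (C1⁺_η) `QuadraticBranchPlusEtaMainConjectureAt V 5` BY NAME on 4 in-table
# CM RANK-ONE partner rows with `λ⁺ = 3` — the rows on which g20/g21 could land only the integral UPPER inclusion (the prime-`L` road needs `λ⁺ = 1`) —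
# from the door-L6 class-number datum ((A) of the partner), the NEW symbol certificate of `μ⁺ = 0` (the λ⁺-reading), Burungale–Tian and Kobayashi
# (seat `bsd-potss-k8eta-c2` g25; consumer of `…PlusCoeffCongruenceMuCertificate`, `EtaFineRoad.etaMC_cmRows_of_bt26_of_conjA_of_analyticMu` (g6/g7),
# `EtaConjADoor.conjA_partner_of_not_dvd_classNumber_stabilizerField` (g20))

WHY. v7's composition settles (C1⁺_η) on a CM row `V` (partner `W`, `C • W^{(5)} = V`) from THREE inputs modulo named facts: statement (A) of
Coates–Sujatha at `(W,5)` (`stub_conjA_partners_cm`), the analytic `μ⁺ = 0` at `V` (`stub_analyticEtaMu_cm`), and Burungale–Tian Thm 2.6 (`h26`,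
cite-level): `EtaFineRoad.etaMC_cmRows_of_bt26_of_conjA_of_analyticMu` (k8eta-c2 g7, p536281-lineage) — ANY rank, ANY shape of `L_5⁺`. Per row,
(A)(W,5) has the fact-free door L6 (`EtaConjADoor.conjA_partner_of_not_dvd_classNumber_stabilizerField`, g20: `5 ∤ h(ℚ(P))` for one `P ∈ W[5] ∖ 0`,
`[ℚ(P):ℚ] = 24`), but `μ⁺ = 0` had NO per-row certificate except on the shapes `Lη ∈ Λˣ` (unit rows, g2/g22) and `(Lη) = (X)` (prime-`L` rank-one rows,
g4/g20) — so the in-table CM rank-one rows with `λ⁺ = 3` (g21's class «integral upper inclusion only») had no (C1⁺_η) record. THIS FILE gives it: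
`μ⁺ = 0` at `V` from the displayed symbol pattern by `EtaPlusCoeffCongruence.analyticEtaMu_row_of_mazurTate_padicNorm` (g25, the λ⁺-reading at
level `2`: `b₀ = 0`, `v₅(b₁), v₅(b₂) ≥ 2`, `v₅(b₃) = 1` with `b_j = ϖ·coeff_jθ₂(η)`), the CM binder from `j(W)` (decidable) transported to the twin
(`X12.hasCM_of_smul_quadraticTwist`), the idle `¬ onto` binder from CM (Zywina: `not_hasSurjectiveModNGaloisRep_of_hasCM`).

WHAT. Per row `W` (literal Cremona minimal equation; CM with `j ∈ cmJInvariants`; `r_an(W) = 1`; twin `V` granted as ONE globally minimal good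
`a_5 = 0` model of `W^{(5)}`, as in every record of this lineage): `isElliptic_<W>`, `isGloballyMinimal_<W>` (Kraus certificate, kernel) and
`etaMC_cm_r1_<W>_5_of_classNumber_of_mazurTate : … → QuadraticBranchPlusEtaMainConjectureAt V 5`. Named facts (hypothesis position): `h26`
(Burungale–Tian 2026 Thm 2.6, cite-level), `h22`, `h6273` (Kobayashi Thm 2.2 / 6.2–7.3 at `η`), `hM` (Mazur `p ∤ c₀`). DISPLAYED per row: the door
datum `hP` (ONE class number of a degree-24 field, PARI/GRH, k8eta-c2 g20/g21 census `E5-TAB-CENSUS-k8eta-c2-g21.tsv`) and the symbol pattern `hθ`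
(λ⁺ + 1 = 4 exact rationals; kit j337268 of k8eta-c2 g25, engine of g23/g24 byte-identical, table `P25-tabcm-j337268.tsv`: `b_j = Σ_u C(u,j)·TH₂[u]`,
`TH₂[u] = Σ_{m ≡ u (25)} η(2)^m [2^m/125]⁺_V`, quoted per row; CONVENTION-INVARIANCE as in `…PlusCoeffCongruenceMuCertificate`: the PATTERN is
independent of the generator of `Γ`, the sign of `η`, `u ↦ −u` and `Ω_V⁺ ∈ {ω₁, 2ω₁}`).

HONEST FRAMING (cell `bsd-potss`; FULL-BSD rank ≤ 1 programme, HUMAN RULING D-0036/D-0074): per-row RECORDS of the crux's conclusion at ONE row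
each, CONDITIONAL on the named facts `h26 h22 h6273 hM` (h26 = a 2026 preprint-level cite binder of the route, exactly as in v7's `_of`) and on two
displayed per-row data (a GRH class number; a symbol pattern = exact rational arithmetic on numerically recovered symbols — evidence, not kernel
facts); NO stub of 19606 is proved (the stubs are class-wide `∀`); `BSD(W,5)` for these rank-one rows would further need the route's open crux
C-cc-1 (19116) — NOT claimed; crux and route OPEN; nothing booked. `--supports stmt-BirchSwinnertonDyer-19606`.

References: [BurungaleTian2026] Thm. 2.6, Rem. 2.7; [Kobayashi2003] Thm. 2.2 (p. 5), Thm. 3.2 (p. 7), §4 (p. 8), Thm. 6.2/6.3/7.3, Cor. 7.2 (p. 13);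
[CoatesSujatha2005] §3 (A), Thm. 3.4, Lemma 3.8; [DeoRaySujatha2023] Thm. 3.8; [Pollack2003] Prop. 6.18; [Mazur1978] Cor. 4.1; [GreenbergVatsal2000] (2);
[SilvermanAEC2009] VII.1 Rem. 1.1, App. C §11; [Kraus1989]; [Cremona1997] Table 1.
-/

set_option autoImplicit false
set_option linter.dupNamespace false

noncomputable section

open scoped Classical MatrixGroups ModularForm nonZeroDivisors

open CongruenceSubgroup NumberField Field WeierstrassCurve
open Literature.NumberTheory.EllipticCurves Literature.NumberTheory.EllipticCurves.ModularForms
  Literature.NumberTheory.EllipticCurves.Rank1Residual Literature.NumberTheory.EllipticCurves.Rank1Residual.Typed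
  Literature.NumberTheory.GaloisRepresentations Literature.NumberTheory.GaloisCohomology Literature.NumberTheory.NumberFields
  Literature.NumberTheory.EllipticCurves.GreenbergVatsal2000 ZpExtension
  Literature.NumberTheory.EllipticCurves.Rank1Residual.X11RankOneCertificates
open Summit.BirchSwinnertonDyer.Rank1Residual Summit.BirchSwinnertonDyer.Rank1Residual.Additive
  Summit.BirchSwinnertonDyer.Rank1Residual.X11b
open Summit.BirchSwinnertonDyer.BirchSwinnertonDyer.Theorems

namespace Summit.BirchSwinnertonDyer.BirchSwinnertonDyer.Theorems.EtaConjADoorEtaMCCMRecords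

/-! ## Row `46225a1` (CM, `j = -884736000`, disc `-43`; `r_an(W) = 1`, `Tam(W) = 4`, `#Ш_an(W) = 1`; twin `N_V = `; PARI `λ⁺ = 3`) -/

/-- `46225a1` = `[0, 0, 1, -21500, 1213406]`: `Δ = -1242296875` `= ±5^6·43^3`, `Δ ≠ 0` (kernel). [cite: Cremona1997, Table 1 (label 46225a1)] -/
theorem isElliptic_46225a1 : (⟨0, 0, 1, (-21500), 1213406⟩ : WeierstrassCurve ℚ).IsElliptic :=
  isElliptic_of_discOf_ne_zero 0 0 1 (-21500) 1213406 (by decide +kernel)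

set_option maxRecDepth 100000 in
/-- `46225a1` is a global minimal equation (Kraus criterion on the support of `Δ`, kernel). [cite: SilvermanAEC2009, VII.1 Remark 1.1] [cite: Kraus1989, Prop. 1–2] -/
theorem isGloballyMinimal_46225a1 : (⟨0, 0, 1, (-21500), 1213406⟩ : WeierstrassCurve ℚ).IsGloballyMinimal :=
  isGloballyMinimal_of_krausCriterion_support 0 0 1 (-21500) 1213406 [(5, 0, 6), (43, 0, 3)]
    (by decide +kernel) (by decide +kernel) (by decide +kernel)

set_option maxRecDepth 100000 in
/-- **(C1⁺_η) — Kobayashi's even main conjecture at `η` for `(V, 5)`, the CRUX'S CONCLUSION — on the CM rank-one row `46225a1`**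
(`W = [0, 0, 1, -21500, 1213406]`, `j = -884736000` (CM by the order of discriminant `-43`), Cremona `r_an = 1`, `Tam = 4`; PARI plus-`η` `(λ, μ) = (3, 0)`;
k8eta-c2 g21 door census: `h(ℚ(P)) = 2` (GRH), door L6 PASS), for every globally minimal good `a_5 = 0` model `V` of `W^{(5)}`
(minimal twin `V = [0, 0, 1, -860, 9707]`), from: named facts `h26 h22 h6273 hM`; DISPLAYED `hP` «`∃ P ∈ W[5] ∖ 0`, `5 ∤ h(ℚ(P))`» (`h = 2`); DISPLAYED `hθ`
«for the newform `f` of `V` and every period ratio `ϖ`: `‖ϖ·coeff_jθ₂(η)‖₅ ≤ 5⁻²` (`j < 3`), `‖ϖ·coeff₃θ₂(η)‖₅ = 5⁻¹`» — THE NUMBERS (kit j337268, row `46225a1`,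
symbols of the minimal twin): `b_0 = 0` (v₅ ∞), `b_1 = -50` (v₅ 2), `b_2 = -500` (v₅ 3), `b_3 = -3490` (v₅ 1), `b_4 = -17590` (v₅ 1) — the registered `λ⁺ = 3` pattern. Chain: (A)(W,5) by door L6 ∘ `μ⁺(V) = 0` by the λ⁺-reading ∘ v7's CM
composition `EtaFineRoad.etaMC_cmRows_of_bt26_of_conjA_of_analyticMu`. CONDITIONAL; nothing booked; `BSD(W,5)` NOT claimed (needs C-cc-1).
[cite: BurungaleTian2026, Thm. 2.6] [cite: Kobayashi2003, §4 (p. 8), Thm. 2.2, Thm. 7.3 i)] [cite: CoatesSujatha2005, §3 Thm. 3.4 and Lemma 3.8]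
[cite: Pollack2003, Prop. 6.18] [cite: Mazur1978, Cor. 4.1] [cite: Cremona1997, Table 1 (label 46225a1)] -/
theorem etaMC_cm_r1_46225a1_5_of_classNumber_of_mazurTate
    (h26 : BurungaleTian2026.thm26_etaKatoSequences_charIdeal_upToP_of_cm)
    (h22 : Kobayashi2003.thm22_etaSignedSelmerDual_finite_torsion)
    (h6273 : Kobayashi2003.thm62_63_73_etaColemanPoitouTate)
    (hM : mazur_not_dvd_maninConstant_of_odd) [Fact (5 : ℕ).Prime]
    (W : WeierstrassCurve ℚ) (hW : W = (⟨0, 0, 1, (-21500), 1213406⟩ : WeierstrassCurve ℚ))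
    (V : WeierstrassCurve ℚ) [V.IsElliptic] [V.IsGloballyMinimal] (C : VariableChange ℚ)
    (hC : C • W.quadraticTwist 5 = V)
    (hgood : V.HasGoodReductionAtPrime 5) (hap : V.frobeniusTrace 5 = 0)
    (hP : haveI : W.IsElliptic := hW ▸ isElliptic_46225a1
      haveI : NeZero (5 : ℕ) := ⟨by norm_num⟩
      haveI : NumberField (W.divisionField 5) := NumberField.mk
      ∃ P : geomTorsion W ((5 : ℕ) : ℤ), P ≠ 0 ∧
        ¬ 5 ∣ NumberField.classNumber (IntermediateField.fixedField
          ((MulAction.stabilizer (absoluteGaloisGroup ℚ) P).map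
            (absRestrictNormalHom (W.divisionField 5)))))
    (hθ : ∀ {N : ℕ} [NeZero N] {f : CuspForm (Gamma0 N) 2}, IsNewformOf V f →
      ∀ (ϖ : ℚ), (if Even (5 / 2) then (ϖ : ℝ) * V.realPeriodRat = plusPeriod f
          else (ϖ : ℝ) * V.imaginaryPeriodRat = minusPeriod f) →
        (∀ j < 3, ‖(ϖ : ℚ_[5]) * (((quadraticBranchMazurTateElement 5 f (2 * 1)).coeff j : ℚ) : ℚ_[5])‖ ≤ ((5 : ℝ)⁻¹) ^ (1 + 1)) ∧
          ‖(ϖ : ℚ_[5]) * (((quadraticBranchMazurTateElement 5 f (2 * 1)).coeff 3 : ℚ) : ℚ_[5])‖ = ((5 : ℝ)⁻¹) ^ 1) :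
    QuadraticBranchPlusEtaMainConjectureAt V 5 := by
  subst hW
  haveI : (⟨0, 0, 1, (-21500), 1213406⟩ : WeierstrassCurve ℚ).IsElliptic := isElliptic_46225a1
  haveI : (⟨0, 0, 1, (-21500), 1213406⟩ : WeierstrassCurve ℚ).IsGloballyMinimal := isGloballyMinimal_46225a1
  haveI : NeZero (5 : ℕ) := ⟨by norm_num⟩
  have hD : ((-1 : ℚ) ^ ((5 : ℕ) / 2) * ((5 : ℕ) : ℚ)) = 5 := by norm_num
  have hC' : C • (⟨0, 0, 1, (-21500), 1213406⟩ : WeierstrassCurve ℚ).quadraticTwist ((-1 : ℚ) ^ ((5 : ℕ) / 2) * ((5 : ℕ) : ℚ)) = V := by rw [hD]; exact hC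
  have hj : (⟨0, 0, 1, (-21500), 1213406⟩ : WeierstrassCurve ℚ).j = ((c4Of [0, 0, 1, (-21500), 1213406] ^ 3 : ℤ) : ℚ) / ((discOf [0, 0, 1, (-21500), 1213406] : ℤ) : ℚ) :=
    @EtaUnitRows.ratCurve_j 0 0 1 (-21500) 1213406 isElliptic_46225a1
  have hCMW : (⟨0, 0, 1, (-21500), 1213406⟩ : WeierstrassCurve ℚ).HasCM := (hasCM_iff_j_mem_holds _).mpr (by rw [hj]; decide +kernel)
  have hCMV : V.HasCM := X12.hasCM_of_smul_quadraticTwist _ hCMW (by norm_num : (5 : ℚ) ≠ 0) V C hC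
  have hns : ¬ ∀ m : ℕ, V.HasSurjectiveModNGaloisRep (5 ^ m : ℕ) := fun h ↦
    V.not_hasSurjectiveModNGaloisRep_of_hasCM hCMV (ℓ := 5) (by norm_num) (by norm_num) (by simpa using h 1)
  have hA := EtaConjADoor.conjA_partner_of_not_dvd_classNumber_stabilizerField V 5 _ C (le_refl 5) hC' hgood hap hns hP
  exact EtaFineRoad.etaMC_cmRows_of_bt26_of_conjA_of_analyticMu h26 h22 h6273 V 5 (le_refl 5) hgood hap hns hCMV _ C hC' hA
    (fun hf ϖ hrel Lη hL ↦ EtaPlusCoeffCongruence.analyticEtaMu_row_of_mazurTate_padicNorm 5 hM (le_refl 5) V hgood hap 1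
      le_rfl 3 (by norm_num) hθ hf ϖ hrel Lη hL)

/-! ## Row `24300t1` (CM, `j = 0`, disc `-3`; `r_an(W) = 1`, `Tam(W) = 6`, `#Ш_an(W) = 1`; twin `N_V = `; PARI `λ⁺ = 3`) -/

/-- `24300t1` = `[0, 0, 0, 0, -375]`: `Δ = -60750000` `= ±2^4·3^5·5^6`, `Δ ≠ 0` (kernel). [cite: Cremona1997, Table 1 (label 24300t1)] -/
theorem isElliptic_24300t1 : (⟨0, 0, 0, 0, (-375)⟩ : WeierstrassCurve ℚ).IsElliptic :=
  isElliptic_of_discOf_ne_zero 0 0 0 0 (-375) (by decide +kernel)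

set_option maxRecDepth 100000 in
/-- `24300t1` is a global minimal equation (Kraus criterion on the support of `Δ`, kernel). [cite: SilvermanAEC2009, VII.1 Remark 1.1] [cite: Kraus1989, Prop. 1–2] -/
theorem isGloballyMinimal_24300t1 : (⟨0, 0, 0, 0, (-375)⟩ : WeierstrassCurve ℚ).IsGloballyMinimal :=
  isGloballyMinimal_of_krausCriterion_support 0 0 0 0 (-375) [(2, 0, 4), (3, 0, 5), (5, 0, 6)]
    (by decide +kernel) (by decide +kernel) (by decide +kernel)

set_option maxRecDepth 100000 in
/-- **(C1⁺_η) — Kobayashi's even main conjecture at `η` for `(V, 5)`, the CRUX'S CONCLUSION — on the CM rank-one row `24300t1`**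
(`W = [0, 0, 0, 0, -375]`, `j = 0` (CM by the order of discriminant `-3`), Cremona `r_an = 1`, `Tam = 6`; PARI plus-`η` `(λ, μ) = (3, 0)`;
k8eta-c2 g21 door census: `h(ℚ(P)) = 3` (GRH), door L6 PASS), for every globally minimal good `a_5 = 0` model `V` of `W^{(5)}`
(minimal twin `V = [0, 0, 0, 0, -3]`), from: named facts `h26 h22 h6273 hM`; DISPLAYED `hP` «`∃ P ∈ W[5] ∖ 0`, `5 ∤ h(ℚ(P))`» (`h = 3`); DISPLAYED `hθ`
«for the newform `f` of `V` and every period ratio `ϖ`: `‖ϖ·coeff_jθ₂(η)‖₅ ≤ 5⁻²` (`j < 3`), `‖ϖ·coeff₃θ₂(η)‖₅ = 5⁻¹`» — THE NUMBERS (kit j337268, row `24300t1`,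
symbols of the minimal twin): `b_0 = 0` (v₅ ∞), `b_1 = 25` (v₅ 2), `b_2 = 125` (v₅ 3), `b_3 = 340` (v₅ 1), `b_4 = 500` (v₅ 3) — the registered `λ⁺ = 3` pattern. Chain: (A)(W,5) by door L6 ∘ `μ⁺(V) = 0` by the λ⁺-reading ∘ v7's CM
composition `EtaFineRoad.etaMC_cmRows_of_bt26_of_conjA_of_analyticMu`. CONDITIONAL; nothing booked; `BSD(W,5)` NOT claimed (needs C-cc-1).
[cite: BurungaleTian2026, Thm. 2.6] [cite: Kobayashi2003, §4 (p. 8), Thm. 2.2, Thm. 7.3 i)] [cite: CoatesSujatha2005, §3 Thm. 3.4 and Lemma 3.8]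
[cite: Pollack2003, Prop. 6.18] [cite: Mazur1978, Cor. 4.1] [cite: Cremona1997, Table 1 (label 24300t1)] -/
theorem etaMC_cm_r1_24300t1_5_of_classNumber_of_mazurTate
    (h26 : BurungaleTian2026.thm26_etaKatoSequences_charIdeal_upToP_of_cm)
    (h22 : Kobayashi2003.thm22_etaSignedSelmerDual_finite_torsion)
    (h6273 : Kobayashi2003.thm62_63_73_etaColemanPoitouTate)
    (hM : mazur_not_dvd_maninConstant_of_odd) [Fact (5 : ℕ).Prime]
    (W : WeierstrassCurve ℚ) (hW : W = (⟨0, 0, 0, 0, (-375)⟩ : WeierstrassCurve ℚ))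
    (V : WeierstrassCurve ℚ) [V.IsElliptic] [V.IsGloballyMinimal] (C : VariableChange ℚ)
    (hC : C • W.quadraticTwist 5 = V)
    (hgood : V.HasGoodReductionAtPrime 5) (hap : V.frobeniusTrace 5 = 0)
    (hP : haveI : W.IsElliptic := hW ▸ isElliptic_24300t1
      haveI : NeZero (5 : ℕ) := ⟨by norm_num⟩
      haveI : NumberField (W.divisionField 5) := NumberField.mk
      ∃ P : geomTorsion W ((5 : ℕ) : ℤ), P ≠ 0 ∧
        ¬ 5 ∣ NumberField.classNumber (IntermediateField.fixedField
          ((MulAction.stabilizer (absoluteGaloisGroup ℚ) P).map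
            (absRestrictNormalHom (W.divisionField 5)))))
    (hθ : ∀ {N : ℕ} [NeZero N] {f : CuspForm (Gamma0 N) 2}, IsNewformOf V f →
      ∀ (ϖ : ℚ), (if Even (5 / 2) then (ϖ : ℝ) * V.realPeriodRat = plusPeriod f
          else (ϖ : ℝ) * V.imaginaryPeriodRat = minusPeriod f) →
        (∀ j < 3, ‖(ϖ : ℚ_[5]) * (((quadraticBranchMazurTateElement 5 f (2 * 1)).coeff j : ℚ) : ℚ_[5])‖ ≤ ((5 : ℝ)⁻¹) ^ (1 + 1)) ∧
          ‖(ϖ : ℚ_[5]) * (((quadraticBranchMazurTateElement 5 f (2 * 1)).coeff 3 : ℚ) : ℚ_[5])‖ = ((5 : ℝ)⁻¹) ^ 1) :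
    QuadraticBranchPlusEtaMainConjectureAt V 5 := by
  subst hW
  haveI : (⟨0, 0, 0, 0, (-375)⟩ : WeierstrassCurve ℚ).IsElliptic := isElliptic_24300t1
  haveI : (⟨0, 0, 0, 0, (-375)⟩ : WeierstrassCurve ℚ).IsGloballyMinimal := isGloballyMinimal_24300t1
  haveI : NeZero (5 : ℕ) := ⟨by norm_num⟩
  have hD : ((-1 : ℚ) ^ ((5 : ℕ) / 2) * ((5 : ℕ) : ℚ)) = 5 := by norm_num
  have hC' : C • (⟨0, 0, 0, 0, (-375)⟩ : WeierstrassCurve ℚ).quadraticTwist ((-1 : ℚ) ^ ((5 : ℕ) / 2) * ((5 : ℕ) : ℚ)) = V := by rw [hD]; exact hC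
  have hj : (⟨0, 0, 0, 0, (-375)⟩ : WeierstrassCurve ℚ).j = ((c4Of [0, 0, 0, 0, (-375)] ^ 3 : ℤ) : ℚ) / ((discOf [0, 0, 0, 0, (-375)] : ℤ) : ℚ) :=
    @EtaUnitRows.ratCurve_j 0 0 0 0 (-375) isElliptic_24300t1
  have hCMW : (⟨0, 0, 0, 0, (-375)⟩ : WeierstrassCurve ℚ).HasCM := (hasCM_iff_j_mem_holds _).mpr (by rw [hj]; decide +kernel)
  have hCMV : V.HasCM := X12.hasCM_of_smul_quadraticTwist _ hCMW (by norm_num : (5 : ℚ) ≠ 0) V C hC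
  have hns : ¬ ∀ m : ℕ, V.HasSurjectiveModNGaloisRep (5 ^ m : ℕ) := fun h ↦
    V.not_hasSurjectiveModNGaloisRep_of_hasCM hCMV (ℓ := 5) (by norm_num) (by norm_num) (by simpa using h 1)
  have hA := EtaConjADoor.conjA_partner_of_not_dvd_classNumber_stabilizerField V 5 _ C (le_refl 5) hC' hgood hap hns hP
  exact EtaFineRoad.etaMC_cmRows_of_bt26_of_conjA_of_analyticMu h26 h22 h6273 V 5 (le_refl 5) hgood hap hns hCMV _ C hC' hA
    (fun hf ϖ hrel Lη hL ↦ EtaPlusCoeffCongruence.analyticEtaMu_row_of_mazurTate_padicNorm 5 hM (le_refl 5) V hgood hap 1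
      le_rfl 3 (by norm_num) hθ hf ϖ hrel Lη hL)

/-! ## Row `43200bk1` (CM, `j = 0`, disc `-3`; `r_an(W) = 1`, `Tam(W) = 2`, `#Ш_an(W) = 1`; twin `N_V = `; PARI `λ⁺ = 3`) -/

/-- `43200bk1` = `[0, 0, 0, 0, 4000]`: `Δ = -6912000000` `= ±2^14·3^3·5^6`, `Δ ≠ 0` (kernel). [cite: Cremona1997, Table 1 (label 43200bk1)] -/
theorem isElliptic_43200bk1 : (⟨0, 0, 0, 0, 4000⟩ : WeierstrassCurve ℚ).IsElliptic :=
  isElliptic_of_discOf_ne_zero 0 0 0 0 4000 (by decide +kernel)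

set_option maxRecDepth 100000 in
/-- `43200bk1` is a global minimal equation (Kraus criterion on the support of `Δ`, kernel). [cite: SilvermanAEC2009, VII.1 Remark 1.1] [cite: Kraus1989, Prop. 1–2] -/
theorem isGloballyMinimal_43200bk1 : (⟨0, 0, 0, 0, 4000⟩ : WeierstrassCurve ℚ).IsGloballyMinimal :=
  isGloballyMinimal_of_krausCriterion_support 0 0 0 0 4000 [(2, 0, 14), (3, 0, 3), (5, 0, 6)]
    (by decide +kernel) (by decide +kernel) (by decide +kernel)

set_option maxRecDepth 100000 in
/-- **(C1⁺_η) — Kobayashi's even main conjecture at `η` for `(V, 5)`, the CRUX'S CONCLUSION — on the CM rank-one row `43200bk1`**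
(`W = [0, 0, 0, 0, 4000]`, `j = 0` (CM by the order of discriminant `-3`), Cremona `r_an = 1`, `Tam = 2`; PARI plus-`η` `(λ, μ) = (3, 0)`;
k8eta-c2 g21 door census: `h(ℚ(P)) = 6` (GRH), door L6 PASS), for every globally minimal good `a_5 = 0` model `V` of `W^{(5)}`
(minimal twin `V = [0, 0, 0, 0, 32]`), from: named facts `h26 h22 h6273 hM`; DISPLAYED `hP` «`∃ P ∈ W[5] ∖ 0`, `5 ∤ h(ℚ(P))`» (`h = 6`); DISPLAYED `hθ`
«for the newform `f` of `V` and every period ratio `ϖ`: `‖ϖ·coeff_jθ₂(η)‖₅ ≤ 5⁻²` (`j < 3`), `‖ϖ·coeff₃θ₂(η)‖₅ = 5⁻¹`» — THE NUMBERS (kit j337268, row `43200bk1`,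
symbols of the minimal twin): `b_0 = 0` (v₅ ∞), `b_1 = 125` (v₅ 3), `b_2 = 1375` (v₅ 3), `b_3 = 7460` (v₅ 1), `b_4 = 26475` (v₅ 2) — the registered `λ⁺ = 3` pattern. Chain: (A)(W,5) by door L6 ∘ `μ⁺(V) = 0` by the λ⁺-reading ∘ v7's CM
composition `EtaFineRoad.etaMC_cmRows_of_bt26_of_conjA_of_analyticMu`. CONDITIONAL; nothing booked; `BSD(W,5)` NOT claimed (needs C-cc-1).
[cite: BurungaleTian2026, Thm. 2.6] [cite: Kobayashi2003, §4 (p. 8), Thm. 2.2, Thm. 7.3 i)] [cite: CoatesSujatha2005, §3 Thm. 3.4 and Lemma 3.8]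
[cite: Pollack2003, Prop. 6.18] [cite: Mazur1978, Cor. 4.1] [cite: Cremona1997, Table 1 (label 43200bk1)] -/
theorem etaMC_cm_r1_43200bk1_5_of_classNumber_of_mazurTate
    (h26 : BurungaleTian2026.thm26_etaKatoSequences_charIdeal_upToP_of_cm)
    (h22 : Kobayashi2003.thm22_etaSignedSelmerDual_finite_torsion)
    (h6273 : Kobayashi2003.thm62_63_73_etaColemanPoitouTate)
    (hM : mazur_not_dvd_maninConstant_of_odd) [Fact (5 : ℕ).Prime]
    (W : WeierstrassCurve ℚ) (hW : W = (⟨0, 0, 0, 0, 4000⟩ : WeierstrassCurve ℚ))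
    (V : WeierstrassCurve ℚ) [V.IsElliptic] [V.IsGloballyMinimal] (C : VariableChange ℚ)
    (hC : C • W.quadraticTwist 5 = V)
    (hgood : V.HasGoodReductionAtPrime 5) (hap : V.frobeniusTrace 5 = 0)
    (hP : haveI : W.IsElliptic := hW ▸ isElliptic_43200bk1
      haveI : NeZero (5 : ℕ) := ⟨by norm_num⟩
      haveI : NumberField (W.divisionField 5) := NumberField.mk
      ∃ P : geomTorsion W ((5 : ℕ) : ℤ), P ≠ 0 ∧
        ¬ 5 ∣ NumberField.classNumber (IntermediateField.fixedField
          ((MulAction.stabilizer (absoluteGaloisGroup ℚ) P).map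
            (absRestrictNormalHom (W.divisionField 5)))))
    (hθ : ∀ {N : ℕ} [NeZero N] {f : CuspForm (Gamma0 N) 2}, IsNewformOf V f →
      ∀ (ϖ : ℚ), (if Even (5 / 2) then (ϖ : ℝ) * V.realPeriodRat = plusPeriod f
          else (ϖ : ℝ) * V.imaginaryPeriodRat = minusPeriod f) →
        (∀ j < 3, ‖(ϖ : ℚ_[5]) * (((quadraticBranchMazurTateElement 5 f (2 * 1)).coeff j : ℚ) : ℚ_[5])‖ ≤ ((5 : ℝ)⁻¹) ^ (1 + 1)) ∧
          ‖(ϖ : ℚ_[5]) * (((quadraticBranchMazurTateElement 5 f (2 * 1)).coeff 3 : ℚ) : ℚ_[5])‖ = ((5 : ℝ)⁻¹) ^ 1) :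
    QuadraticBranchPlusEtaMainConjectureAt V 5 := by
  subst hW
  haveI : (⟨0, 0, 0, 0, 4000⟩ : WeierstrassCurve ℚ).IsElliptic := isElliptic_43200bk1
  haveI : (⟨0, 0, 0, 0, 4000⟩ : WeierstrassCurve ℚ).IsGloballyMinimal := isGloballyMinimal_43200bk1
  haveI : NeZero (5 : ℕ) := ⟨by norm_num⟩
  have hD : ((-1 : ℚ) ^ ((5 : ℕ) / 2) * ((5 : ℕ) : ℚ)) = 5 := by norm_num
  have hC' : C • (⟨0, 0, 0, 0, 4000⟩ : WeierstrassCurve ℚ).quadraticTwist ((-1 : ℚ) ^ ((5 : ℕ) / 2) * ((5 : ℕ) : ℚ)) = V := by rw [hD]; exact hC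
  have hj : (⟨0, 0, 0, 0, 4000⟩ : WeierstrassCurve ℚ).j = ((c4Of [0, 0, 0, 0, 4000] ^ 3 : ℤ) : ℚ) / ((discOf [0, 0, 0, 0, 4000] : ℤ) : ℚ) :=
    @EtaUnitRows.ratCurve_j 0 0 0 0 4000 isElliptic_43200bk1
  have hCMW : (⟨0, 0, 0, 0, 4000⟩ : WeierstrassCurve ℚ).HasCM := (hasCM_iff_j_mem_holds _).mpr (by rw [hj]; decide +kernel)
  have hCMV : V.HasCM := X12.hasCM_of_smul_quadraticTwist _ hCMW (by norm_num : (5 : ℚ) ≠ 0) V C hC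
  have hns : ¬ ∀ m : ℕ, V.HasSurjectiveModNGaloisRep (5 ^ m : ℕ) := fun h ↦
    V.not_hasSurjectiveModNGaloisRep_of_hasCM hCMV (ℓ := 5) (by norm_num) (by norm_num) (by simpa using h 1)
  have hA := EtaConjADoor.conjA_partner_of_not_dvd_classNumber_stabilizerField V 5 _ C (le_refl 5) hC' hgood hap hns hP
  exact EtaFineRoad.etaMC_cmRows_of_bt26_of_conjA_of_analyticMu h26 h22 h6273 V 5 (le_refl 5) hgood hap hns hCMV _ C hC' hA
    (fun hf ϖ hrel Lη hL ↦ EtaPlusCoeffCongruence.analyticEtaMu_row_of_mazurTate_padicNorm 5 hM (le_refl 5) V hgood hap 1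
      le_rfl 3 (by norm_num) hθ hf ϖ hrel Lη hL)

/-! ## Row `108900n1` (CM, `j = 0`, disc `-3`; `r_an(W) = 1`, `Tam(W) = 24`, `#Ш_an(W) = 1`; twin `N_V = `; PARI `λ⁺ = 3`) -/

/-- `108900n1` = `[0, 0, 0, 0, -166375]`: `Δ = -11958036750000` `= ±2^4·3^3·5^6·11^6`, `Δ ≠ 0` (kernel). [cite: Cremona1997, Table 1 (label 108900n1)] -/
theorem isElliptic_108900n1 : (⟨0, 0, 0, 0, (-166375)⟩ : WeierstrassCurve ℚ).IsElliptic :=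
  isElliptic_of_discOf_ne_zero 0 0 0 0 (-166375) (by decide +kernel)

set_option maxRecDepth 100000 in
/-- `108900n1` is a global minimal equation (Kraus criterion on the support of `Δ`, kernel). [cite: SilvermanAEC2009, VII.1 Remark 1.1] [cite: Kraus1989, Prop. 1–2] -/
theorem isGloballyMinimal_108900n1 : (⟨0, 0, 0, 0, (-166375)⟩ : WeierstrassCurve ℚ).IsGloballyMinimal :=
  isGloballyMinimal_of_krausCriterion_support 0 0 0 0 (-166375) [(2, 0, 4), (3, 0, 3), (5, 0, 6), (11, 0, 6)]
    (by decide +kernel) (by decide +kernel) (by decide +kernel)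

set_option maxRecDepth 100000 in
/-- **(C1⁺_η) — Kobayashi's even main conjecture at `η` for `(V, 5)`, the CRUX'S CONCLUSION — on the CM rank-one row `108900n1`**
(`W = [0, 0, 0, 0, -166375]`, `j = 0` (CM by the order of discriminant `-3`), Cremona `r_an = 1`, `Tam = 24`; PARI plus-`η` `(λ, μ) = (3, 0)`;
k8eta-c2 g21 door census: `h(ℚ(P)) = 8` (GRH), door L6 PASS), for every globally minimal good `a_5 = 0` model `V` of `W^{(5)}`
(minimal twin `V = [0, 0, 0, 0, -1331]`), from: named facts `h26 h22 h6273 hM`; DISPLAYED `hP` «`∃ P ∈ W[5] ∖ 0`, `5 ∤ h(ℚ(P))`» (`h = 8`); DISPLAYED `hθ`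
«for the newform `f` of `V` and every period ratio `ϖ`: `‖ϖ·coeff_jθ₂(η)‖₅ ≤ 5⁻²` (`j < 3`), `‖ϖ·coeff₃θ₂(η)‖₅ = 5⁻¹`» — THE NUMBERS (kit j337268, row `108900n1`,
symbols of the minimal twin): `b_0 = 0` (v₅ ∞), `b_1 = -75` (v₅ 2), `b_2 = 450` (v₅ 2), `b_3 = 6065` (v₅ 1), `b_4 = 35730` (v₅ 1) — the registered `λ⁺ = 3` pattern. Chain: (A)(W,5) by door L6 ∘ `μ⁺(V) = 0` by the λ⁺-reading ∘ v7's CM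
composition `EtaFineRoad.etaMC_cmRows_of_bt26_of_conjA_of_analyticMu`. CONDITIONAL; nothing booked; `BSD(W,5)` NOT claimed (needs C-cc-1).
[cite: BurungaleTian2026, Thm. 2.6] [cite: Kobayashi2003, §4 (p. 8), Thm. 2.2, Thm. 7.3 i)] [cite: CoatesSujatha2005, §3 Thm. 3.4 and Lemma 3.8]
[cite: Pollack2003, Prop. 6.18] [cite: Mazur1978, Cor. 4.1] [cite: Cremona1997, Table 1 (label 108900n1)] -/
theorem etaMC_cm_r1_108900n1_5_of_classNumber_of_mazurTate
    (h26 : BurungaleTian2026.thm26_etaKatoSequences_charIdeal_upToP_of_cm)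
    (h22 : Kobayashi2003.thm22_etaSignedSelmerDual_finite_torsion)
    (h6273 : Kobayashi2003.thm62_63_73_etaColemanPoitouTate)
    (hM : mazur_not_dvd_maninConstant_of_odd) [Fact (5 : ℕ).Prime]
    (W : WeierstrassCurve ℚ) (hW : W = (⟨0, 0, 0, 0, (-166375)⟩ : WeierstrassCurve ℚ))
    (V : WeierstrassCurve ℚ) [V.IsElliptic] [V.IsGloballyMinimal] (C : VariableChange ℚ)
    (hC : C • W.quadraticTwist 5 = V)
    (hgood : V.HasGoodReductionAtPrime 5) (hap : V.frobeniusTrace 5 = 0)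
    (hP : haveI : W.IsElliptic := hW ▸ isElliptic_108900n1
      haveI : NeZero (5 : ℕ) := ⟨by norm_num⟩
      haveI : NumberField (W.divisionField 5) := NumberField.mk
      ∃ P : geomTorsion W ((5 : ℕ) : ℤ), P ≠ 0 ∧
        ¬ 5 ∣ NumberField.classNumber (IntermediateField.fixedField
          ((MulAction.stabilizer (absoluteGaloisGroup ℚ) P).map
            (absRestrictNormalHom (W.divisionField 5)))))
    (hθ : ∀ {N : ℕ} [NeZero N] {f : CuspForm (Gamma0 N) 2}, IsNewformOf V f →
      ∀ (ϖ : ℚ), (if Even (5 / 2) then (ϖ : ℝ) * V.realPeriodRat = plusPeriod f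
          else (ϖ : ℝ) * V.imaginaryPeriodRat = minusPeriod f) →
        (∀ j < 3, ‖(ϖ : ℚ_[5]) * (((quadraticBranchMazurTateElement 5 f (2 * 1)).coeff j : ℚ) : ℚ_[5])‖ ≤ ((5 : ℝ)⁻¹) ^ (1 + 1)) ∧
          ‖(ϖ : ℚ_[5]) * (((quadraticBranchMazurTateElement 5 f (2 * 1)).coeff 3 : ℚ) : ℚ_[5])‖ = ((5 : ℝ)⁻¹) ^ 1) :
    QuadraticBranchPlusEtaMainConjectureAt V 5 := by
  subst hW
  haveI : (⟨0, 0, 0, 0, (-166375)⟩ : WeierstrassCurve ℚ).IsElliptic := isElliptic_108900n1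
  haveI : (⟨0, 0, 0, 0, (-166375)⟩ : WeierstrassCurve ℚ).IsGloballyMinimal := isGloballyMinimal_108900n1
  haveI : NeZero (5 : ℕ) := ⟨by norm_num⟩
  have hD : ((-1 : ℚ) ^ ((5 : ℕ) / 2) * ((5 : ℕ) : ℚ)) = 5 := by norm_num
  have hC' : C • (⟨0, 0, 0, 0, (-166375)⟩ : WeierstrassCurve ℚ).quadraticTwist ((-1 : ℚ) ^ ((5 : ℕ) / 2) * ((5 : ℕ) : ℚ)) = V := by rw [hD]; exact hC
  have hj : (⟨0, 0, 0, 0, (-166375)⟩ : WeierstrassCurve ℚ).j = ((c4Of [0, 0, 0, 0, (-166375)] ^ 3 : ℤ) : ℚ) / ((discOf [0, 0, 0, 0, (-166375)] : ℤ) : ℚ) :=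
    @EtaUnitRows.ratCurve_j 0 0 0 0 (-166375) isElliptic_108900n1
  have hCMW : (⟨0, 0, 0, 0, (-166375)⟩ : WeierstrassCurve ℚ).HasCM := (hasCM_iff_j_mem_holds _).mpr (by rw [hj]; decide +kernel)
  have hCMV : V.HasCM := X12.hasCM_of_smul_quadraticTwist _ hCMW (by norm_num : (5 : ℚ) ≠ 0) V C hC
  have hns : ¬ ∀ m : ℕ, V.HasSurjectiveModNGaloisRep (5 ^ m : ℕ) := fun h ↦
    V.not_hasSurjectiveModNGaloisRep_of_hasCM hCMV (ℓ := 5) (by norm_num) (by norm_num) (by simpa using h 1)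
  have hA := EtaConjADoor.conjA_partner_of_not_dvd_classNumber_stabilizerField V 5 _ C (le_refl 5) hC' hgood hap hns hP
  exact EtaFineRoad.etaMC_cmRows_of_bt26_of_conjA_of_analyticMu h26 h22 h6273 V 5 (le_refl 5) hgood hap hns hCMV _ C hC' hA
    (fun hf ϖ hrel Lη hL ↦ EtaPlusCoeffCongruence.analyticEtaMu_row_of_mazurTate_padicNorm 5 hM (le_refl 5) V hgood hap 1
      le_rfl 3 (by norm_num) hθ hf ϖ hrel Lη hL)

end Summit.BirchSwinnertonDyer.BirchSwinnertonDyer.Theorems.EtaConjADoorEtaMCCMRecords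

end
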